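import Summits.NavierStokesRegularity.FunctionalMining.StretchingLaminateBurkholderCap
import Literature.Probability.Process.BurkholderConcavity
import HarnessLib

/-!
# FunctionalMining — K1-Q1 laminates: `BurkConcave` HOLDS, so the L-CAP-B kernel cap `C_lam ≤ 49/50` is UNCONDITIONAL

search for candidate a priori estimates; no regularity claim.

Cell `pub-nsfunc` (literature seat gen 11, bridging file).  The typed hypothesis `Laminate.BurkConcave` of
`…BurkholderConcave.lean` (prove seat gen 7) — the concavity clause of Burkholder's key function in `ℝ⁶` — is the
`E = E6` instance of the Literature THEOREM `Literature.Probability.Process.burkholderU_concaveOn`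
(`Literature/Probability/Process/BurkholderConcavity.lean`: Burkholder 1991, LNM 1464, §8, proof of (8.10), "The function
`G` is concave on `I`", formalised for every real inner product space).  Hence the laminate cap of
`…BurkholderCap.lean` holds unconditionally: `Laminate.laminateSupConst_le_49_50 : laminateSupConst ≤ 49/50`, with the window
`422/625 ≤ C_lam ≤ 49/50`.  A cap on the laminate METHOD only; nothing here concerns Navier–Stokes solutions.
-/

noncomputable section

namespace Summit.NavierStokesRegularity.FunctionalMining

namespace Laminate

open Literature.Probability.Process

/-- **`BurkConcave` holds**: the concavity clause of Burkholder's key function in `ℝ⁶` is a theorem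
(instance `E = E6` of `Literature.Probability.Process.burkholderU_concaveOn`). [ours; bookkeeping over a cited theorem] -/
theorem burkConcave_holds : BurkConcave :=
  fun _lam hlam x y h k hx hxh hk => burkholderU_concaveOn hlam x y h k hx hxh hk

/-- **THEOREM L-CAP-B, unconditional in the kernel**: `C_lam ≤ 49/50 = 0.98`. [ours] -/
theorem laminateSupConst_le_49_50 : laminateSupConst ≤ 49 / 50 :=
  laminateSupConst_le_of_burkConcave burkConcave_holds

/-- `RatioBound (49/50)` unconditionally. [ours] -/
theorem ratioBound_49_50 : RatioBound (49 / 50) :=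
  ratioBound_of_burkConcave burkConcave_holds

/-- The unconditional kernel window for the laminate constant: `422/625 ≤ C_lam ≤ 49/50`. [ours] -/
theorem laminateSupConst_window_49_50 :
    (422 / 625 : ℝ) ≤ laminateSupConst ∧ laminateSupConst ≤ 49 / 50 :=
  ⟨e800_le_laminateSupConst, laminateSupConst_le_49_50⟩

end Laminate

end Summit.NavierStokesRegularity.FunctionalMining

end
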